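import Summits.ResolutionOfSingularities.ResolutionOfSingularities.Theorems.FrobeniusLadderFRationalResolutionToricVertexUnique
import Summits.ResolutionOfSingularities.ResolutionOfSingularities.Theorems.FrobeniusLadderFRationalResolutionVeroneseNotRegular
import Mathlib.RingTheory.RegularLocalRing.Defs
import HarnessLib

/-!
# Toric surface programme: the vertex of `U(r,a)` is a singular point (`1 ≤ a < r`)

Support file for crux stmt-ResolutionOfSingularities-15317 (`FrobeniusLadder.FRationalResolution`),
line `redirect`, lead c4 (toric surface programme: all affine toric surfaces
`U(r,a) = Spec k[{m ∈ ℤ² : 0 ≤ m₂, a m₂ ≤ r m₁}]` over every field lie in the crux's residual class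
and are resolved by the Hirzebruch–Jung tower; this file certifies that these members of the class
are genuinely SINGULAR: the torus-fixed point is not a regular point). Stub
`stub_toric_vertex_not_regular`.

Let `R = TA[r,a] = k[σ∨ ∩ ℤ²] ⊆ k[ℤ²]`, `1 ≤ a < r`, and let `q` be the vertex, the prime containing
`x = χ^(1,0)` and `w = χ^(a,r)`; by `toricVertex_mem_iff`, `t ∈ q ↔ t(0) = 0`.

Proof (denominator clearing, no cotangent spaces — the pattern of
`veronese_not_isRegularRing_of_subalgebra`). If `R_q` were regular, then since
`dim R_q = ht q ≤ dim R = 2` its maximal ideal is generated by `≤ 2` elements, and after clearing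
denominators (`veronese_not_isRegularRing_exists_finset`) there are `b₁, b₂ ∈ q` such that every
`g ∈ q` has `u g ∈ (b₁, b₂) R` for some `u ∉ q`. The toric replacement for the "degree-`2`
component" of the Veronese argument is the INDECOMPOSABLE PART: call a lattice point `m` of `σ∨`
indecomposable if `m = m₁ + m₂` with `m₁, m₂ ∈ σ∨` forces `m₁ = 0` or `m₂ = 0`, and let `π` be the
`k`-linear projection of `k[ℤ²]` onto the monomials with indecomposable exponent. For `t ∈ R` and
`g ∈ q` one has `π(t g) = t(0) • π(g)` (`toricSing_coeff_mul`: a cone monomial times a non-constant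
cone monomial is indecomposable only if the first factor is `1`), so `π(g) ∈ k π(b₁) + k π(b₂)` for
every `g ∈ q`, in particular for `g = χ^m` with `m` indecomposable, where `π(χ^m) = χ^m`. But there
are three distinct nonzero indecomposable points: `(1,0)`, `(1,1)` (every nonzero cone point has
`m₁ ≥ 1`, `toricSing_fst_pos`, so points with `m₁ = 1` are indecomposable,
`toricSing_indecomp_of_fst_eq_one`) and one with `m₁ < m₂` (`toricSing_exists_indecomp`: descent on
`m₁` from `(a,r)`, `a < r`), giving three linearly independent vectors in a plane — contradiction.
[folklore; cf. CLS2011 Thm. 1.3.12 / Prop. 11.1.8 (a cone is smooth iff its Hilbert basis has `dim`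
elements); BrunsHerzog1998, Ex. 2.2.24] Only Mathlib's `AddMonoidAlgebra` / `Algebra.adjoin` /
`IsRegularLocalRing` API and the tree files above are used; no named published fact.
-/

set_option linter.dupNamespace false

noncomputable section

namespace Summit.ResolutionOfSingularities.ResolutionOfSingularities.Theorems.FRationalResolution

section Toric

variable (k : Type) [Field k]

/-- The Laurent polynomial ring `k[ℤ²]` (coordinate ring of the 2-torus). -/
local notation3 "Lk" => AddMonoidAlgebra k (ℤ × ℤ)

/-- The lattice points of the dual cone `σ∨ = {m₂ ≥ 0, a m₂ ≤ r m₁}` of `σ = cone((0,1),(r,-a))`. -/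
local notation3 "σS[" r ", " a "]" =>
  {m : ℤ × ℤ | 0 ≤ m.2 ∧ ((a : ℕ) : ℤ) * m.2 ≤ ((r : ℕ) : ℤ) * m.1}

/-- The toric surface algebra `k[σ∨ ∩ ℤ²] ⊆ k[ℤ²]`. -/
local notation3 "TA[" r ", " a "]" =>
  Algebra.adjoin k ((fun m : ℤ × ℤ => AddMonoidAlgebra.single m (1 : k)) '' σS[r, a])

/-- **Nonzero cone points have `m₁ ≥ 1`.** For `1 ≤ a` and `1 ≤ r`, a nonzero lattice point `m` of
`σ∨ = {m₂ ≥ 0, a m₂ ≤ r m₁}` has `1 ≤ m₁`: if `m₁ ≤ 0` then `a m₂ ≤ r m₁ ≤ 0` forces `m₂ = 0`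
and then `0 ≤ r m₁` forces `m₁ = 0`. [folklore] -/
theorem toricSing_fst_pos (r a : ℕ) (ha : 1 ≤ a) (hr : 1 ≤ r) (m : ℤ × ℤ) (hm : m ∈ σS[r, a])
    (hm0 : m ≠ 0) : 1 ≤ m.1 := by
  obtain ⟨h2, hc⟩ := hm
  have ha' : (1 : ℤ) ≤ a := by exact_mod_cast ha
  have hr' : (1 : ℤ) ≤ r := by exact_mod_cast hr
  by_contra hlt
  push Not at hlt
  have h1 : (r : ℤ) * m.1 ≤ 0 := mul_nonpos_of_nonneg_of_nonpos (by positivity) (by omega)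
  have h3 : (a : ℤ) * m.2 ≤ 0 := hc.trans h1
  have h4 : m.2 ≤ 0 := by nlinarith
  have h5 : m.2 = 0 := le_antisymm h4 h2
  rw [h5, mul_zero] at hc
  have h6 : m.1 = 0 := by nlinarith
  exact hm0 (Prod.ext h6 h5)

/-- **Cone points with `m₁ = 1` are indecomposable** (`1 ≤ a`, `1 ≤ r`): if `m₁ + m₂ = m` with
`m₁, m₂ ∈ σ∨` both nonzero, then the first coordinates add up to `≥ 2` (`toricSing_fst_pos`).
[folklore] -/
theorem toricSing_indecomp_of_fst_eq_one (r a : ℕ) (ha : 1 ≤ a) (hr : 1 ≤ r) (m : ℤ × ℤ)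
    (hm1 : m.1 = 1) :
    ∀ m₁ ∈ σS[r, a], ∀ m₂ ∈ σS[r, a], m₁ + m₂ = m → m₁ = 0 ∨ m₂ = 0 := by
  intro m₁ hm₁ m₂ hm₂ hsum
  by_contra h
  push Not at h
  have h1 := toricSing_fst_pos r a ha hr m₁ hm₁ h.1
  have h2 := toricSing_fst_pos r a ha hr m₂ hm₂ h.2
  have h12 : m₁.1 + m₂.1 = 1 := by rw [← Prod.fst_add, hsum, hm1]
  omega

/-- **A third indecomposable cone point.** For `1 ≤ a < r` there is an indecomposable lattice point
`p` of `σ∨` with `p₁ < p₂` (so `p ∉ {0, (1,0), (1,1)}`): start from `(a, r) ∈ σ∨` and descend — a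
decomposable point with `m₁ < m₂` splits into two nonzero cone points of strictly smaller first
coordinate (`toricSing_fst_pos`), one of which again has `m₁ < m₂`. [folklore; the Hilbert basis of a
non-smooth two-dimensional cone has `≥ 3` elements, CLS2011 §10.2] -/
theorem toricSing_exists_indecomp (r a : ℕ) (ha : 1 ≤ a) (har : a < r) :
    ∃ p ∈ σS[r, a], p.1 < p.2 ∧
      ∀ m₁ ∈ σS[r, a], ∀ m₂ ∈ σS[r, a], m₁ + m₂ = p → m₁ = 0 ∨ m₂ = 0 := by
  have hr : 1 ≤ r := by omega
  have key : ∀ n : ℕ, ∀ m ∈ σS[r, a], m.1 < m.2 → m.1 ≤ n → ∃ p ∈ σS[r, a], p.1 < p.2 ∧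
      ∀ m₁ ∈ σS[r, a], ∀ m₂ ∈ σS[r, a], m₁ + m₂ = p → m₁ = 0 ∨ m₂ = 0 := by
    intro n
    induction n with
    | zero =>
      intro m hm hlt hle
      have hm0 : m ≠ 0 := by
        rintro rfl
        simp at hlt
      have h1 := toricSing_fst_pos r a ha hr m hm hm0
      push_cast at hle
      omega
    | succ n ih =>
      intro m hm hlt hle
      by_cases hind : ∀ m₁ ∈ σS[r, a], ∀ m₂ ∈ σS[r, a], m₁ + m₂ = m → m₁ = 0 ∨ m₂ = 0
      · exact ⟨m, hm, hlt, hind⟩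
      · push Not at hind
        obtain ⟨m₁, hm₁, m₂, hm₂, hsum, h10, h20⟩ := hind
        have h1 := toricSing_fst_pos r a ha hr m₁ hm₁ h10
        have h2 := toricSing_fst_pos r a ha hr m₂ hm₂ h20
        have hfst : m₁.1 + m₂.1 = m.1 := by rw [← Prod.fst_add, hsum]
        have hsnd : m₁.2 + m₂.2 = m.2 := by rw [← Prod.snd_add, hsum]
        push_cast at hle
        by_cases hlt1 : m₁.1 < m₁.2
        · exact ih m₁ hm₁ hlt1 (by omega)
        · exact ih m₂ hm₂ (by omega) (by omega)
  have harS : (((a : ℕ) : ℤ), ((r : ℕ) : ℤ)) ∈ σS[r, a] :=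
    ⟨by positivity, by rw [mul_comm]⟩
  exact key a _ harS (show (a : ℤ) < r by exact_mod_cast har) (show (a : ℤ) ≤ a from le_rfl)

/-- **Supports of elements of `TA[r,a]` lie in the cone**: `TA[r,a]` is the `k`-span of the cone
monomials (`toricVertex_mem_span`), and the set of elements of `k[ℤ²]` supported on `σ∨ ∩ ℤ²` is a
`k`-subspace containing them. [folklore] -/
theorem toricSing_mem_of_coeff_ne_zero (r a : ℕ) (t : Lk) (ht : t ∈ TA[r, a]) (m : ℤ × ℤ)
    (h : t.coeff m ≠ 0) : m ∈ σS[r, a] := by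
  revert m
  refine Submodule.span_induction (p := fun t _ => ∀ m, t.coeff m ≠ 0 → m ∈ σS[r, a]) ?_ ?_ ?_ ?_
    (toricVertex_mem_span k r a t ht)
  · rintro _ ⟨m', hm', rfl⟩ m h
    rw [AddMonoidAlgebra.coeff_single, Finsupp.single_apply_ne_zero] at h
    exact h.1 ▸ hm'
  · intro m h
    simp at h
  · intro u v _ _ hu hv m h
    by_contra hm
    have hu0 : u.coeff m = 0 := not_not.mp (mt (hu m) hm)
    have hv0 : v.coeff m = 0 := not_not.mp (mt (hv m) hm)
    apply h
    rw [AddMonoidAlgebra.coeff_add, Finsupp.add_apply, hu0, hv0, add_zero]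
  · intro c u _ hu m h
    refine hu m fun h0 => h ?_
    rw [AddMonoidAlgebra.coeff_smul, Finsupp.smul_apply, h0, smul_zero]

/-- **Indecomposable coefficients of a product.** If `t, g ∈ TA[r,a]`, `g` has zero constant term
and `m` is an indecomposable point of `σ∨`, then the `χ^m`-coefficient of `t g` is `t(0) g_m`: in
`χ^{m'} · g` (`m' ∈ σ∨`) the monomial `χ^m` can only arise as `χ^{m'} χ^{m''}` with `m'' ≠ 0` in the
support of `g`, hence `m''∈ σ∨ ∖ 0` (`toricSing_mem_of_coeff_ne_zero`), and indecomposability forces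
`m' = 0`. Extend `k`-linearly in `t` over the cone monomials (`toricVertex_mem_span`). [folklore] -/
theorem toricSing_coeff_mul (r a : ℕ) (t g : Lk) (ht : t ∈ TA[r, a]) (hg : g ∈ TA[r, a])
    (hg0 : g.coeff 0 = 0) (m : ℤ × ℤ)
    (hind : ∀ m₁ ∈ σS[r, a], ∀ m₂ ∈ σS[r, a], m₁ + m₂ = m → m₁ = 0 ∨ m₂ = 0) :
    (t * g).coeff m = t.coeff 0 * g.coeff m := by
  classical
  have hsupp : ∀ m' ∈ g.coeff.support, m' ∈ σS[r, a] ∧ m' ≠ 0 := fun m' hm' =>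
    ⟨toricSing_mem_of_coeff_ne_zero k r a g hg m' (Finsupp.mem_support_iff.mp hm'),
      fun h0 => Finsupp.mem_support_iff.mp hm' (by rw [h0]; exact hg0)⟩
  refine Submodule.span_induction (p := fun t _ => (t * g).coeff m = t.coeff 0 * g.coeff m)
    ?_ ?_ ?_ ?_ (toricVertex_mem_span k r a t ht)
  · rintro _ ⟨m', hm', rfl⟩
    by_cases h0 : m' = 0
    · subst h0
      rw [AddMonoidAlgebra.coeff_single_mul_eq_mul_coeff (m₂ := m) (fun m'' _ => by rw [zero_add]),
        AddMonoidAlgebra.coeff_single, Finsupp.single_eq_same]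
    · rw [AddMonoidAlgebra.coeff_single_mul_eq_mul_coeff (m₂ := 0) ?_, hg0,
        AddMonoidAlgebra.coeff_single, Finsupp.single_eq_of_ne' h0, mul_zero, zero_mul]
      intro m'' hm''
      obtain ⟨hm''S, hm''0⟩ := hsupp m'' hm''
      refine ⟨fun hsum => ?_, fun h => absurd h hm''0⟩
      rcases hind m' hm' m'' hm''S hsum with h | h
      · exact absurd h h0
      · exact absurd h hm''0
  · simp
  · intro u v _ _ hu hv
    rw [add_mul, AddMonoidAlgebra.coeff_add, Finsupp.add_apply, hu, hv, AddMonoidAlgebra.coeff_add,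
      Finsupp.add_apply, add_mul]
  · intro c u _ hu
    rw [smul_mul_assoc, AddMonoidAlgebra.coeff_smul, Finsupp.smul_apply, hu,
      AddMonoidAlgebra.coeff_smul, Finsupp.smul_apply, smul_eq_mul, smul_eq_mul, mul_assoc]

/-- **THE VERTEX OF `U(r,a)` IS SINGULAR FOR `1 ≤ a < r`** (registered stub
`stub_toric_vertex_not_regular`, crux stmt-ResolutionOfSingularities-15317, line `redirect`). For the
toric surface algebra `TA[r,a] = k[σ∨ ∩ ℤ²]` of Krull dimension `2` with facet monomials
`x = χ^(1,0)`, `w = χ^(a,r)` and `q` the vertex (the prime containing `x` and `w`), the local ring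
`TA[r,a]_q` is not regular: otherwise `q TA[r,a]_q` has `≤ 2` generators, denominators clear to
`b₁, b₂ ∈ q` (`veronese_not_isRegularRing_exists_finset`), and projecting onto the indecomposable
monomials (`toricSing_coeff_mul`) puts the three independent monomials `χ^(1,0)`, `χ^(1,1)`, `χ^p`
(`toricSing_exists_indecomp`) in the plane spanned by the projections of `b₁, b₂`.
[folklore; CLS2011 Thm. 1.3.12 / Prop. 11.1.8; cf. BrunsHerzog1998, Ex. 2.2.24] -/
theorem stub_toric_vertex_not_regular (r a : ℕ) (ha : 1 ≤ a) (har : a < r) (hdim : ringKrullDim ↥TA[r, a] = 2)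
    (x w : ↥TA[r, a]) (hx : (x : Lk) = AddMonoidAlgebra.single ((1 : ℤ), (0 : ℤ)) 1)
    (hw : (w : Lk) = AddMonoidAlgebra.single ((a : ℤ), (r : ℤ)) 1)
    (q : PrimeSpectrum ↥TA[r, a]) (hq : x ∈ q.asIdeal ∧ w ∈ q.asIdeal) :
    ¬ IsRegularLocalRing (Localization.AtPrime q.asIdeal) := by
  classical
  intro hreg
  have hr : 1 ≤ r := by omega
  -- membership in the vertex is vanishing of the constant coefficient
  have hmem : ∀ t : ↥TA[r, a], t ∈ q.asIdeal ↔ (t : Lk).coeff 0 = 0 :=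
    fun t => toricVertex_mem_iff k r a hr x w hx hw q.asIdeal hq.1 hq.2 t
  -- `TA[r,a]_q` is regular local of dimension `ht q ≤ dim TA[r,a] = 2`: `≤ 2` generators
  have hn : (IsLocalRing.maximalIdeal (Localization.AtPrime q.asIdeal)).spanFinrank ≤ 2 := by
    have h := hreg.spanFinrank_maximalIdeal.trans_le
      ((IsLocalization.AtPrime.ringKrullDim_eq_height q.asIdeal
        (Localization.AtPrime q.asIdeal)).trans_le
        (Ideal.height_le_ringKrullDim_of_isPrime.trans hdim.le))
    exact_mod_cast h
  haveI : IsNoetherianRing (Localization.AtPrime q.asIdeal) := hreg.toIsNoetherian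
  obtain ⟨s, hscard, hsm, hsgen⟩ := veronese_not_isRegularRing_exists_finset q.asIdeal
    (IsNoetherian.noetherian _) hn
  -- the indecomposable part `f` of an element of `TA[r,a]`
  set P : ℤ × ℤ → Prop := fun m =>
    ∀ m₁ ∈ σS[r, a], ∀ m₂ ∈ σS[r, a], m₁ + m₂ = m → m₁ = 0 ∨ m₂ = 0 with hP
  set f : ↥TA[r, a] → (ℤ × ℤ) →₀ k := fun y => (y : Lk).coeff.filter P with hf
  have hf_add : ∀ y z : ↥TA[r, a], f (y + z) = f y + f z := by
    intro y z
    simp only [hf, Subalgebra.coe_add, AddMonoidAlgebra.coeff_add, Finsupp.filter_add]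
  have hf_mul : ∀ c y : ↥TA[r, a], (y : Lk).coeff 0 = 0 → f (c * y) = ((c : Lk).coeff 0) • f y := by
    intro c y hy0
    ext m
    simp only [hf, Subalgebra.coe_mul, Finsupp.filter_apply, Finsupp.smul_apply, smul_eq_mul]
    split_ifs with hPm
    · exact toricSing_coeff_mul k r a _ _ c.2 y.2 hy0 m hPm
    · exact (mul_zero _).symm
  -- the indecomposable parts of elements of `q` span a plane `V` ...
  have hV : ∀ g : ↥TA[r, a], g ∈ q.asIdeal →
      f g ∈ Submodule.span k (↑(s.image f) : Set ((ℤ × ℤ) →₀ k)) := by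
    intro g hg
    obtain ⟨u, hu, hug⟩ := hsgen g hg
    have hu0 : (u : Lk).coeff 0 ≠ 0 := fun h => hu ((hmem u).mpr h)
    have key : u * g ∈ q.asIdeal ∧
        f (u * g) ∈ Submodule.span k (↑(s.image f) : Set ((ℤ × ℤ) →₀ k)) := by
      refine Submodule.span_induction
        (p := fun y _ => y ∈ q.asIdeal ∧
          f y ∈ Submodule.span k (↑(s.image f) : Set ((ℤ × ℤ) →₀ k))) ?_ ?_ ?_ ?_ hug
      · intro z hz
        exact ⟨hsm z hz, Submodule.subset_span
          (Finset.mem_coe.mpr (Finset.mem_image_of_mem f (Finset.mem_coe.mp hz)))⟩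
      · refine ⟨Ideal.zero_mem _, ?_⟩
        have h0 : f 0 = 0 := by
          simp only [hf, ZeroMemClass.coe_zero, AddMonoidAlgebra.coeff_zero, Finsupp.filter_zero]
        rw [h0]
        exact Submodule.zero_mem _
      · rintro y z - - ⟨hyq, hy⟩ ⟨hzq, hz⟩
        refine ⟨Ideal.add_mem _ hyq hzq, ?_⟩
        rw [hf_add]
        exact Submodule.add_mem _ hy hz
      · rintro c y - ⟨hyq, hy⟩
        refine ⟨Ideal.mul_mem_left _ c hyq, ?_⟩
        rw [smul_eq_mul, hf_mul c y ((hmem y).mp hyq)]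
        exact Submodule.smul_mem _ _ hy
    have h := key.2
    rw [hf_mul u g ((hmem g).mp hg)] at h
    exact (Submodule.smul_mem_iff _ hu0).mp h
  -- ... containing `χ^m` for every nonzero indecomposable cone point `m`
  have hin : ∀ m ∈ σS[r, a], m ≠ 0 → P m →
      Finsupp.single m (1 : k) ∈
        (Submodule.span k (↑(s.image f) : Set ((ℤ × ℤ) →₀ k)) : Set ((ℤ × ℤ) →₀ k)) := by
    intro m hmS hm0 hPm
    have hmem' : (⟨AddMonoidAlgebra.single m (1 : k), Algebra.subset_adjoin ⟨m, hmS, rfl⟩⟩ :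
        ↥TA[r, a]) ∈ q.asIdeal := by
      rw [hmem, AddMonoidAlgebra.coeff_single]
      exact Finsupp.single_eq_of_ne' hm0
    have h := hV _ hmem'
    simp only [hf, AddMonoidAlgebra.coeff_single, Finsupp.filter_single_of_pos _ hPm] at h
    exact h
  -- three distinct nonzero indecomposables: `(1,0)`, `(1,1)` and `p` with `p₁ < p₂`
  obtain ⟨p, hpS, hplt, hpind⟩ := toricSing_exists_indecomp r a ha har
  have hp10 : p ≠ ((1 : ℤ), (0 : ℤ)) := by
    rintro rfl
    simp at hplt
  have hp11 : p ≠ ((1 : ℤ), (1 : ℤ)) := by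
    rintro rfl
    simp at hplt
  have hp0 : p ≠ 0 := by
    rintro rfl
    simp at hplt
  have h10S : ((1 : ℤ), (0 : ℤ)) ∈ σS[r, a] := ⟨le_rfl, by simp⟩
  have h11S : ((1 : ℤ), (1 : ℤ)) ∈ σS[r, a] := ⟨zero_le_one, by simpa using har.le⟩
  set T : Finset (ℤ × ℤ) := {((1 : ℤ), (0 : ℤ)), ((1 : ℤ), (1 : ℤ)), p} with hT
  have hT3 : T.card = 3 :=
    Finset.card_eq_three.mpr ⟨_, _, _, by simp, hp10.symm, hp11.symm, rfl⟩
  have hrange : Set.range (fun m : ↥T => Finsupp.single (m : ℤ × ℤ) (1 : k)) ⊆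
      (Submodule.span k (↑(s.image f) : Set ((ℤ × ℤ) →₀ k)) : Set ((ℤ × ℤ) →₀ k)) := by
    rintro _ ⟨⟨m, hmT⟩, rfl⟩
    simp only [hT, Finset.mem_insert, Finset.mem_singleton] at hmT
    rcases hmT with rfl | rfl | rfl
    · exact hin _ h10S (by simp) (toricSing_indecomp_of_fst_eq_one r a ha hr _ rfl)
    · exact hin _ h11S (by simp) (toricSing_indecomp_of_fst_eq_one r a ha hr _ rfl)
    · exact hin _ hpS hp0 hpind
  have hli : LinearIndependent k (fun m : ↥T => Finsupp.single (m : ℤ × ℤ) (1 : k)) :=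
    (Finsupp.linearIndependent_single_one k (ℤ × ℤ)).comp _ Subtype.val_injective
  have h3 : Cardinal.mk ↥T ≤ (s.image f).card := by
    simpa only [Finset.coe_sort_coe, Fintype.card_coe] using
      linearIndependent_le_span' _ hli _ hrange
  have h3' : 3 ≤ (s.image f).card := by
    rw [Cardinal.mk_coe_finset, hT3] at h3
    exact_mod_cast h3
  have h2 : (s.image f).card ≤ 2 := Finset.card_image_le.trans hscard
  omega

end Toric

end Summit.ResolutionOfSingularities.ResolutionOfSingularities.Theorems.FRationalResolution

end
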